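/-
Copyright (c) 2026. All rights reserved.
Released under Apache 2.0 license as described in the file LICENSE.
-/
import Literature.NumberTheory.LFunctions.HardyZFirstApprox
import Literature.NumberTheory.LFunctions.DirichletPolyBilinearMVT
import Summits.RiemannHypothesis.RiemannHypothesis.Theorems.UniversalFactorNarrowKernelNoGoEnergyLowerBound
import Summits.RiemannHypothesis.RiemannHypothesis.Theorems.UniversalFactorNarrowKernelNoGoEnergyLowerCoeffs
import Summits.RiemannHypothesis.RiemannHypothesis.Theorems.UniversalFactorNarrowKernelNoGoEnergyLowerBlockArith

/-!
# Narrow-kernel no-go, line `Sketch`: the clean narrow energy lower bound (stub K1a-clean)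

For `a > π/8`, `κ_a(u) = e^{−2a|u|} e^{−πu/4}` and `g(t) = ∫ κ_a(u) Z(t+u) du`, we prove
`∫_{T'}^{T'+U} g² ≥ c₁ U` for every block `[T', T'+U]` with `s⁸ ≤ T' ≤ 2 s⁸`,
`s⁶/2 ≤ U ≤ s⁶`, `s ≥ S₀(a)` (`UniversalFactor.narrowClean_block`), and by tiling `[T, 2T]`
(`s = T^{1/8}`, `⌈s²⌉` blocks) the registered stub

* `UniversalFactor.stub_narrowEnergyLowerClean` : `∫_T^{2T} g² ≥ c₁ T` for `T ≥ T₁(a)`.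

The block bound is the duality argument `∫ g² ≥ ‖∫ g X‖² / ∫ ‖X‖²` with the test function
`X = conj(E₁) · D`, `D(t) = Σ_{n ∈ V} conj(q_n) n^{-1/2} n^{it}` on the window `V = (N/e², N/e]`,
`N = √(T'/2π)`: the block identity (`narrowBlock_integrated`) gives
`∫ g X = U Σ_V ‖q_n‖²/n + O_a(s⁵)`, the mean-value theorem gives `∫ ‖X‖² ≤ 2 U Σ_V ‖q_n‖²/n`,
and `Σ_V ‖q_n‖²/n ≥ m_a²/2`.  No Riemann–Siegel pointwise formula and no fourth moment is used.

Crux `stmt-RiemannHypothesis-2576` (`UniversalFactor.NarrowKernelNoGo`), line `Sketch`.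
References: Titchmarsh (1986) §7.3–7.4; Montgomery–Vaughan (1974).
-/

set_option linter.dupNamespace false  -- D-0017 nested layout: `RiemannHypothesis.RiemannHypothesis`

namespace Summit.RiemannHypothesis.RiemannHypothesis.Theorems

open MeasureTheory Set Filter Complex intervalIntegral
open scoped Real Topology ComplexConjugate
open Literature.NumberTheory.LFunctions Literature.NumberTheory.LFunctions.TwistedMoment

/-! ## Coefficient bounds and the first-approximation error on a block -/

/-- **Bounds for the resonant test coefficients** `c_n = conj(q_n) n^{-1/2} 1_V(n)` on a block:
the diagonal, the energy window `m²/2 ≤ Σ_V ‖q_n‖²/n ≤ 3K₀²`, `Σ n‖c_n‖² ≤ N K₀² ≤ K₀² s⁴`,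
`Σ ‖c_n‖ ≤ 2 K₀ s²`, `Σ_{μ ≤ P} μ^{-1/2} ≤ 2 s²`, and the support condition `8πν² ≤ T'`.
[folklore] -/
theorem UniversalFactor.narrowClean_coeffBounds {a : ℝ} (ha : π / 8 < a) {L s T' : ℝ} {P : ℕ}
    (hs : 0 < s) (hN42 : 42 ≤ Real.exp L) (hNs4 : Real.exp L ≤ s ^ 4) (hPs4 : (P : ℝ) ≤ s ^ 4)
    (hfloorP : ⌊Real.exp L / Real.exp 1⌋₊ ≤ P)
    (hνT : ∀ ν : ℕ, (ν : ℝ) ≤ Real.exp L / Real.exp 1 → 8 * π * (ν : ℝ) ^ 2 ≤ T')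
    (c : ℕ → ℂ) (hc : ∀ n : ℕ, c n = if n ∈ Finset.Icc (⌊Real.exp L / Real.exp 2⌋₊ + 1) ⌊Real.exp L / Real.exp 1⌋₊ then
      conj (∫ u : ℝ, ((Real.exp (-(2 * a * |u|)) * Real.exp (-(π * u / 4)) : ℝ) : ℂ) * cexp (I * (L - Real.log n) * u)) * (((n : ℝ) ^ (-(1 / 2 : ℝ)) : ℝ) : ℂ) else 0) :
    (∑ n ∈ Finset.Icc 1 P, c n * (((n : ℝ) ^ (-(1 / 2 : ℝ)) : ℝ) : ℂ) * ∫ u : ℝ, ((Real.exp (-(2 * a * |u|)) * Real.exp (-(π * u / 4)) : ℝ) : ℂ) * cexp (I * (L - Real.log n) * u) =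
      ((∑ n ∈ Finset.Icc (⌊Real.exp L / Real.exp 2⌋₊ + 1) ⌊Real.exp L / Real.exp 1⌋₊, ‖∫ u : ℝ, ((Real.exp (-(2 * a * |u|)) * Real.exp (-(π * u / 4)) : ℝ) : ℂ) * cexp (I * (L - Real.log n) * u)‖ ^ 2 / n : ℝ) : ℂ)) ∧
    (4 * a / (2 * a + π / 4 + 2) ^ 2) ^ 2 / 2 ≤ ∑ n ∈ Finset.Icc (⌊Real.exp L / Real.exp 2⌋₊ + 1) ⌊Real.exp L / Real.exp 1⌋₊, ‖∫ u : ℝ, ((Real.exp (-(2 * a * |u|)) * Real.exp (-(π * u / 4)) : ℝ) : ℂ) * cexp (I * (L - Real.log n) * u)‖ ^ 2 / n ∧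
    ∑ n ∈ Finset.Icc (⌊Real.exp L / Real.exp 2⌋₊ + 1) ⌊Real.exp L / Real.exp 1⌋₊, ‖∫ u : ℝ, ((Real.exp (-(2 * a * |u|)) * Real.exp (-(π * u / 4)) : ℝ) : ℂ) * cexp (I * (L - Real.log n) * u)‖ ^ 2 / n ≤ 3 * (∫ u : ℝ, Real.exp (-(2 * a * |u|)) * Real.exp (-(π * u / 4))) ^ 2 ∧
    ∑ n ∈ Finset.Icc 1 P, ‖c n‖ ^ 2 = ∑ n ∈ Finset.Icc (⌊Real.exp L / Real.exp 2⌋₊ + 1) ⌊Real.exp L / Real.exp 1⌋₊, ‖∫ u : ℝ, ((Real.exp (-(2 * a * |u|)) * Real.exp (-(π * u / 4)) : ℝ) : ℂ) * cexp (I * (L - Real.log n) * u)‖ ^ 2 / n ∧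
    ∑ n ∈ Finset.Icc 1 P, (n : ℝ) * ‖c n‖ ^ 2 ≤ Real.exp L * (∫ u : ℝ, Real.exp (-(2 * a * |u|)) * Real.exp (-(π * u / 4))) ^ 2 ∧
    ∑ n ∈ Finset.Icc 1 P, (n : ℝ) * ‖c n‖ ^ 2 ≤ (∫ u : ℝ, Real.exp (-(2 * a * |u|)) * Real.exp (-(π * u / 4))) ^ 2 * s ^ 4 ∧
    ∑ n ∈ Finset.Icc 1 P, ‖c n‖ ≤ 2 * (∫ u : ℝ, Real.exp (-(2 * a * |u|)) * Real.exp (-(π * u / 4))) * s ^ 2 ∧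
    ∑ μ ∈ Finset.Icc 1 P, (μ : ℝ) ^ (-(1 / 2 : ℝ)) ≤ 2 * s ^ 2 ∧
    (∀ ν ∈ Finset.Icc 1 P, c ν ≠ 0 → 8 * π * (ν : ℝ) ^ 2 ≤ T') := by
  obtain ⟨hCmain, hCn, hC2, hC1, hCsupp⟩ := UniversalFactor.narrowBlockCoeff_sums a L hfloorP c hc
  have hK₀ := (UniversalFactor.integral_narrowKer_pos ha).le
  have hsqrtP : Real.sqrt P ≤ s ^ 2 := by
    refine (Real.sqrt_le_sqrt hPs4).trans_eq ?_
    rw [show s ^ 4 = (s ^ 2) ^ 2 by ring, Real.sqrt_sq (by positivity)]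
  refine ⟨hCmain, UniversalFactor.narrowCoeff_energy_ge ha hN42, UniversalFactor.narrowCoeff_energy_le a hN42,
    hC2, ?_, ?_, ?_, ?_, ?_⟩
  · rw [hCn]
    exact UniversalFactor.narrowCoeff_sq_sum_le a L
  · rw [hCn]
    refine (UniversalFactor.narrowCoeff_sq_sum_le a L).trans ?_
    calc Real.exp L * (∫ u : ℝ, Real.exp (-(2 * a * |u|)) * Real.exp (-(π * u / 4))) ^ 2 ≤ s ^ 4 * (∫ u : ℝ, Real.exp (-(2 * a * |u|)) * Real.exp (-(π * u / 4))) ^ 2 :=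
          mul_le_mul_of_nonneg_right hNs4 (sq_nonneg _)
      _ = _ := by ring
  · rw [hC1]
    refine (UniversalFactor.narrowCoeff_l1_le a L hfloorP).trans ?_
    exact mul_le_mul_of_nonneg_left hsqrtP (by positivity)
  · refine (sum_Icc_rpow_neg_half_le P).trans ?_
    linarith
  · intro ν _ hν
    obtain ⟨_, _, h3⟩ := UniversalFactor.narrowWindow_mem (Real.exp_pos L).le (hCsupp ν hν)
    exact hνT ν h3

/-- **Mean square of the first-approximation error over an extended block**:
`∫_{T'-s}^{T'+U+s} |hardyZErr P|² ≤ 13 C₂ s⁴` for `P = ⌊√((T'-s)/2π)⌋`, `s⁸/2 ≤ T' - s`,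
`U ≤ s⁶`, `s ≥ max(2, T₁)`. [folklore] -/
theorem UniversalFactor.narrowClean_errBound {C₂ T₁ₑ : ℝ} (hC₂ : 0 < C₂)
    (herr : ∀ T T₂ : ℝ, T₁ₑ ≤ T → T ≤ T₂ →
      ∫ t in T..T₂, ‖hardyZErr ⌊Real.sqrt (T / (2 * π))⌋₊ t‖ ^ 2 ≤
        C₂ * (1 + (T₂ - T) / Real.sqrt T + (T₂ - T) ^ 2 / T))
    {s T' U : ℝ} (hs2 : 2 ≤ s) (hsT₁ : T₁ₑ ≤ s) (hT₀ : s ^ 8 / 2 ≤ T' - s) (hU0 : 0 ≤ U)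
    (hU2 : U ≤ s ^ 6) :
    ∫ t in (T' - s)..(T' + U + s), ‖hardyZErr ⌊Real.sqrt ((T' - s) / (2 * π))⌋₊ t‖ ^ 2 ≤
      13 * C₂ * s ^ 4 := by
  have hs0 : 0 < s := by linarith
  have hs1 : 1 ≤ s := by linarith
  have h26 : 2 * s ≤ s ^ 6 := by
    calc 2 * s ≤ 2 ^ 5 * s := by linarith
      _ ≤ s ^ 5 * s := mul_le_mul_of_nonneg_right (pow_le_pow_left₀ (by norm_num) hs2 5) hs0.le
      _ = s ^ 6 := by ring
  have h68 : s ^ 6 ≤ s ^ 8 := pow_le_pow_right₀ hs1 (by norm_num)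
  have hT₀pos : 0 < T' - s := by nlinarith
  have hT₁T : T₁ₑ ≤ T' - s := by nlinarith
  have h := herr (T' - s) (T' + U + s) hT₁T (by linarith)
  have hsq : s ^ 4 / 2 ≤ Real.sqrt (T' - s) := by
    refine (Real.le_sqrt (by positivity) hT₀pos.le).2 ?_
    rw [show (s ^ 4 / 2) ^ 2 = s ^ 8 / 4 by ring]
    linarith
  have hsqpos : 0 < Real.sqrt (T' - s) := Real.sqrt_pos.2 hT₀pos
  have hnum : T' + U + s - (T' - s) ≤ 2 * s ^ 6 := by linarith
  have hnum0 : 0 ≤ T' + U + s - (T' - s) := by linarith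
  have hA1 : (T' + U + s - (T' - s)) / Real.sqrt (T' - s) ≤ 4 * s ^ 2 := by
    rw [div_le_iff₀ hsqpos]
    calc T' + U + s - (T' - s) ≤ 2 * s ^ 6 := hnum
      _ = 4 * s ^ 2 * (s ^ 4 / 2) := by ring
      _ ≤ 4 * s ^ 2 * Real.sqrt (T' - s) := mul_le_mul_of_nonneg_left hsq (by positivity)
  have hA2 : (T' + U + s - (T' - s)) ^ 2 / (T' - s) ≤ 8 * s ^ 4 := by
    rw [div_le_iff₀ hT₀pos]
    calc (T' + U + s - (T' - s)) ^ 2 ≤ (2 * s ^ 6) ^ 2 := pow_le_pow_left₀ hnum0 hnum 2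
      _ = 8 * s ^ 4 * (s ^ 8 / 2) := by ring
      _ ≤ 8 * s ^ 4 * (T' - s) := mul_le_mul_of_nonneg_left hT₀ (by positivity)
  have h14 : 1 ≤ s ^ 4 := one_le_pow₀ hs1
  have h24 : s ^ 2 ≤ s ^ 4 := pow_le_pow_right₀ hs1 (by norm_num)
  calc _ ≤ C₂ * (1 + (T' + U + s - (T' - s)) / Real.sqrt (T' - s) +
        (T' + U + s - (T' - s)) ^ 2 / (T' - s)) := h
    _ ≤ C₂ * (13 * s ^ 4) := mul_le_mul_of_nonneg_left (by linarith) hC₂.le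
    _ = 13 * C₂ * s ^ 4 := by ring

/-- **Block lower bound for the clean energy.**  For `a > π/8` there are `c₁ > 0` and `S₀` with
`∫_{T'}^{T'+U} (∫ κ_a(u) Z(t+u) du)² dt ≥ c₁ U` whenever `s ≥ S₀`, `s⁸ ≤ T' ≤ 2s⁸` and
`s⁶/2 ≤ U ≤ s⁶`.  Duality with the resonant test polynomial on the window `(N/e², N/e]`.
[folklore] -/
theorem UniversalFactor.narrowClean_block {a : ℝ} (ha : π / 8 < a) :
    ∃ c₁ S₀ : ℝ, 0 < c₁ ∧ ∀ s T' U : ℝ, S₀ ≤ s → s ^ 8 ≤ T' → T' ≤ 2 * s ^ 8 → s ^ 6 / 2 ≤ U →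
      U ≤ s ^ 6 → c₁ * U ≤ ∫ t in T'..(T' + U), (∫ u : ℝ, Real.exp (-(2 * a * |u|)) * Real.exp (-(π * u / 4)) * hardyZ (t + u)) ^ 2 := by
  -- constants depending on `a` only
  obtain ⟨K₀, hK₀⟩ : ∃ K : ℝ, K = ∫ u : ℝ, Real.exp (-(2 * a * |u|)) * Real.exp (-(π * u / 4)) := ⟨_, rfl⟩
  obtain ⟨K₁, hK₁⟩ : ∃ K : ℝ, K = ∫ u : ℝ, |u| * (Real.exp (-(2 * a * |u|)) * Real.exp (-(π * u / 4))) := ⟨_, rfl⟩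
  obtain ⟨K₂, hK₂⟩ : ∃ K : ℝ, K = ∫ u : ℝ, u ^ 2 * (Real.exp (-(2 * a * |u|)) * Real.exp (-(π * u / 4))) := ⟨_, rfl⟩
  have hK₀pos : 0 < K₀ := hK₀ ▸ UniversalFactor.integral_narrowKer_pos ha
  have hK₁0 : 0 ≤ K₁ := hK₁ ▸ MeasureTheory.integral_nonneg fun u => by positivity
  have hK₂0 : 0 ≤ K₂ := hK₂ ▸ MeasureTheory.integral_nonneg fun u => by positivity
  have hc0 : 0 < 2 * a - π / 4 := UniversalFactor.narrowKer_rate_pos ha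
  obtain ⟨M₁, hM₁pos, hM₁⟩ := UniversalFactor.narrow_integral_pow_mul_ker_tail ha 1
  obtain ⟨M', hM'0, hM'⟩ : ∃ M' : ℝ, 0 ≤ M' ∧ ∀ x : ℝ,
      (1 + |x|) ^ 11 * Real.exp (-((2 * a - π / 4) / 2 * |x|)) ≤ M' := by
    refine ⟨(min 1 ((2 * a - π / 4) / 2 / (2 * (11 : ℕ) + 2)))⁻¹ ^ 11, by positivity, fun x => ?_⟩
    refine (UniversalFactor.narrow_one_add_abs_pow_mul_exp_le_half (half_pos hc0) 11 x).trans ?_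
    refine mul_le_of_le_one_right (by positivity) (Real.exp_le_one_iff.2 ?_)
    have : 0 ≤ (2 * a - π / 4) / 2 / 2 * |x| := by positivity
    linarith
  obtain ⟨C₂, T₁ₑ, hC₂pos, hT₁ₑ, herr⟩ := integral_norm_sq_hardyZErr_le
  obtain ⟨m, hm0, hm⟩ : ∃ m : ℝ, 0 < m ∧ m = 4 * a / (2 * a + π / 4 + 2) ^ 2 :=
    ⟨_, UniversalFactor.narrowCoeff_lower_pos ha, rfl⟩
  obtain ⟨A, hA⟩ : ∃ A : ℝ, A = K₀ * (3712 * (1 + K₀ ^ 2) + 12 * K₀ + 13 * C₂ + 1859 * K₀ ^ 2) +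
      (K₁ + K₂) * (1859 * K₀ ^ 2 + 1861) + 18 * K₀ * M₁ * M' := ⟨_, rfl⟩
  have hA0 : 0 ≤ A := by rw [hA]; positivity
  refine ⟨m ^ 2 / 32, 4 + T₁ₑ + 8 * A / m ^ 2 + (4 * 1856 * K₀ ^ 2 / m ^ 2 + 1), by positivity, ?_⟩
  intro s T' U hs hT'1 hT'2 hU1 hU2
  have hAm : 0 ≤ 8 * A / m ^ 2 := by positivity
  have hKm : 0 ≤ 4 * 1856 * K₀ ^ 2 / m ^ 2 := by positivity
  have hs4 : 4 ≤ s := by linarith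
  have hs2 : 2 ≤ s := by linarith
  have hs1 : 1 ≤ s := by linarith
  have hs0 : 0 < s := by linarith
  have hsT₁ : T₁ₑ ≤ s := by linarith
  have hsA : 8 * A / m ^ 2 ≤ s := by linarith
  have hsK : 4 * 1856 * K₀ ^ 2 / m ^ 2 ≤ s - 1 := by linarith
  have hU0 : 0 ≤ U := le_trans (by positivity) hU1
  -- block parameters
  obtain ⟨hT'0, hsT', hT₀, hN42, hNs4, -, hPs4, hP2, hfloorP, hνT, hlP0, hlPs⟩ :=
    UniversalFactor.narrowClean_params hs4 hT'1 hT'2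
  set L : ℝ := Real.log (T' / (2 * π)) / 2 with hL
  set P : ℕ := ⌊Real.sqrt ((T' - s) / (2 * π))⌋₊ with hP
  -- the test coefficients and their sums
  obtain ⟨c, hc⟩ : ∃ c : ℕ → ℂ, ∀ n : ℕ, c n = if n ∈ Finset.Icc (⌊Real.exp L / Real.exp 2⌋₊ + 1) ⌊Real.exp L / Real.exp 1⌋₊ then conj (∫ u : ℝ, ((Real.exp (-(2 * a * |u|)) * Real.exp (-(π * u / 4)) : ℝ) : ℂ) * cexp (I * (L - Real.log n) * u)) * (((n : ℝ) ^ (-(1 / 2 : ℝ)) : ℝ) : ℂ) else 0 :=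
    ⟨fun n => if n ∈ Finset.Icc (⌊Real.exp L / Real.exp 2⌋₊ + 1) ⌊Real.exp L / Real.exp 1⌋₊ then conj (∫ u : ℝ, ((Real.exp (-(2 * a * |u|)) * Real.exp (-(π * u / 4)) : ℝ) : ℂ) * cexp (I * (L - Real.log n) * u)) * (((n : ℝ) ^ (-(1 / 2 : ℝ)) : ℝ) : ℂ) else 0, fun n => rfl⟩
  obtain ⟨hCmain, hSVge, hSVle, hC2, hSnCN, hSnCs, hSC1s, hSμs, hcT⟩ :=
    UniversalFactor.narrowClean_coeffBounds ha hs0 hN42 hNs4 hPs4 hfloorP hνT c hc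
  rw [← hm] at hSVge
  rw [← hK₀] at hSVle hSnCN hSnCs hSC1s
  set SV : ℝ := ∑ n ∈ Finset.Icc (⌊Real.exp L / Real.exp 2⌋₊ + 1) ⌊Real.exp L / Real.exp 1⌋₊, ‖∫ u : ℝ, ((Real.exp (-(2 * a * |u|)) * Real.exp (-(π * u / 4)) : ℝ) : ℂ) * cexp (I * (L - Real.log n) * u)‖ ^ 2 / n with hSV
  have hSC10 : 0 ≤ ∑ n ∈ Finset.Icc 1 P, ‖c n‖ := Finset.sum_nonneg fun n _ => norm_nonneg _
  have hSμ0 : 0 ≤ ∑ μ ∈ Finset.Icc 1 P, (μ : ℝ) ^ (-(1 / 2 : ℝ)) :=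
    Finset.sum_nonneg fun n _ => Real.rpow_nonneg (Nat.cast_nonneg n) _
  -- the mean square of the Dirichlet polynomial `D`
  obtain ⟨ID, hID⟩ : ∃ J : ℝ, J = ∫ t in T'..(T' + U),
      ‖∑ n ∈ Finset.Icc 1 P, c n * (n : ℂ) ^ ((t : ℂ) * I)‖ ^ 2 := ⟨_, rfl⟩
  have hID0 : 0 ≤ ID := hID ▸ intervalIntegral.integral_nonneg (by linarith) fun t _ => sq_nonneg _
  have hIDle : ID ≤ U * SV + 1856 * (Real.exp L * K₀ ^ 2) := by
    have h := abs_integral_norm_sq_dirichletPoly_sub_le P c T' (T' + U)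
    rw [← hID, hC2, show T' + U - T' = U by ring] at h
    have h' := (abs_le.1 h).2
    linarith [hSnCN]
  have hIDs : ID ≤ 1859 * K₀ ^ 2 * s ^ 6 := by
    have h46 : s ^ 4 ≤ s ^ 6 := pow_le_pow_right₀ hs1 (by norm_num)
    have hSV0 : 0 ≤ SV := le_trans (by positivity) hSVge
    have h1 : U * SV ≤ s ^ 6 * (3 * K₀ ^ 2) := mul_le_mul hU2 hSVle hSV0 (by positivity)
    have h2 : Real.exp L * K₀ ^ 2 ≤ s ^ 6 * K₀ ^ 2 :=
      mul_le_mul_of_nonneg_right (hNs4.trans h46) (sq_nonneg K₀)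
    linarith
  -- the size comparisons `1856 N K₀² ≤ U·SV`, `A s⁵ ≤ U·SV/2`
  have hUSV : m ^ 2 * s ^ 6 / 4 ≤ U * SV := by
    have hm2 : 0 ≤ m ^ 2 / 2 := by positivity
    have := mul_le_mul hU1 hSVge hm2 hU0
    linarith
  have hUSVpos : 0 < U * SV := lt_of_lt_of_le (by positivity) hUSV
  have hAs : A * s ^ 5 ≤ U * SV / 2 := by
    have h1 : 8 * A ≤ m ^ 2 * s := by
      have := (div_le_iff₀ (by positivity : (0 : ℝ) < m ^ 2)).1 hsA
      linarith
    have h2 : 8 * A * s ^ 5 ≤ m ^ 2 * s ^ 6 := by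
      calc 8 * A * s ^ 5 ≤ (m ^ 2 * s) * s ^ 5 := mul_le_mul_of_nonneg_right h1 (pow_nonneg hs0.le 5)
        _ = m ^ 2 * s ^ 6 := by ring
    linarith
  have hNK : 1856 * (Real.exp L * K₀ ^ 2) ≤ U * SV := by
    have h1 : 4 * 1856 * K₀ ^ 2 ≤ m ^ 2 * s := by
      have := (div_le_iff₀ (by positivity : (0 : ℝ) < m ^ 2)).1 hsK
      have hm2 : 0 < m ^ 2 := by positivity
      nlinarith only [this, hm2]
    have h2 : 4 * 1856 * K₀ ^ 2 * s ^ 4 ≤ m ^ 2 * s ^ 6 := by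
      calc 4 * 1856 * K₀ ^ 2 * s ^ 4 ≤ (m ^ 2 * s) * s ^ 4 :=
            mul_le_mul_of_nonneg_right h1 (pow_nonneg hs0.le 4)
        _ = m ^ 2 * s ^ 5 := by ring
        _ ≤ m ^ 2 * s ^ 6 := mul_le_mul_of_nonneg_left (pow_le_pow_right₀ hs1 (by norm_num)) (sq_nonneg m)
    have h3 := mul_le_mul_of_nonneg_right hNs4 (sq_nonneg K₀)
    linarith
  have hID2 : ID ≤ 2 * (U * SV) := by linarith
  -- the first-approximation error and the kernel tail
  obtain ⟨Ie, hIe⟩ : ∃ J : ℝ, J = ∫ t in (T' - s)..(T' + U + s), ‖hardyZErr P t‖ ^ 2 := ⟨_, rfl⟩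
  have hIes : Ie ≤ 13 * C₂ * s ^ 4 := hIe ▸ UniversalFactor.narrowClean_errBound hC₂pos herr hs2 hsT₁ hT₀ hU0 hU2
  obtain ⟨Tail, hTail⟩ : ∃ J : ℝ, J = ∫ u in {v : ℝ | s < |v|}, (1 + |u|) ^ 1 * (Real.exp (-(2 * a * |u|)) * Real.exp (-(π * u / 4))) := ⟨_, rfl⟩
  have hTails : Tail ≤ M₁ * Real.exp (-((2 * a - π / 4) / 2 * s)) := hTail ▸ hM₁ s hs0.le
  have hEs : s ^ 11 * Real.exp (-((2 * a - π / 4) / 2 * s)) ≤ M' := by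
    have h := hM' s
    rw [abs_of_nonneg hs0.le] at h
    refine le_trans (mul_le_mul_of_nonneg_right ?_ (Real.exp_pos _).le) h
    exact pow_le_pow_left₀ hs0.le (by linarith) 11
  -- the block identity and its error (the large terms stay inside this `have`)
  have hclose : ‖(∫ t in T'..(T' + U),
      ((∫ u : ℝ, Real.exp (-(2 * a * |u|)) * Real.exp (-(π * u / 4)) * hardyZ (t + u) : ℝ) : ℂ) *
        (conj (thetaMainPhase t) * ∑ n ∈ Finset.Icc 1 P, c n * (n : ℂ) ^ ((t : ℂ) * I))) -
        U * SV‖ ≤ U * SV / 2 := by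
    have hblock := UniversalFactor.narrowBlock_integrated ha P c hT'0 hU0 hs0.le hsT' hs0 hP2 hcT
    rw [← hK₀, ← hK₁, ← hK₂, ← hID, ← hIe, ← hTail, hCmain] at hblock
    have hERR := UniversalFactor.narrowBlock_arith hs2 hK₀pos.le hK₁0 hK₂0 hC₂pos.le hM₁pos.le
      (Nat.cast_nonneg P) hPs4 hSnCs hSμ0 hSμs hSC10 hSC1s hIes hID0 hIDs hU0 hU2 hT'1 hT'2 hlP0 hlPs
      hTails (Real.exp_pos _).le hEs
    rw [← hA] at hERR
    exact (hblock.trans hERR).trans hAs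
  -- the main term dominates: `‖∫ g X‖ ≥ U·SV/2`
  have hJ : U * SV / 2 ≤ ‖∫ t in T'..(T' + U),
      ((∫ u : ℝ, Real.exp (-(2 * a * |u|)) * Real.exp (-(π * u / 4)) * hardyZ (t + u) : ℝ) : ℂ) *
        (conj (thetaMainPhase t) * ∑ n ∈ Finset.Icc 1 P, c n * (n : ℂ) ^ ((t : ℂ) * I))‖ := by
    have hm : ‖(U : ℂ) * (SV : ℂ)‖ = U * SV := by
      rw [← Complex.ofReal_mul, Complex.norm_real, Real.norm_of_nonneg hUSVpos.le]
    have h := norm_sub_norm_le ((U : ℂ) * (SV : ℂ)) (∫ t in T'..(T' + U),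
      ((∫ u : ℝ, Real.exp (-(2 * a * |u|)) * Real.exp (-(π * u / 4)) * hardyZ (t + u) : ℝ) : ℂ) *
        (conj (thetaMainPhase t) * ∑ n ∈ Finset.Icc 1 P, c n * (n : ℂ) ^ ((t : ℂ) * I)))
    rw [hm, norm_sub_rev] at h
    linarith
  -- duality
  have hg : ContinuousOn (fun t : ℝ => ∫ u : ℝ, Real.exp (-(2 * a * |u|)) * Real.exp (-(π * u / 4)) * hardyZ (t + u)) (Icc T' (T' + U)) :=
    (UniversalFactor.narrowSmooth_continuous ha).continuousOn
  have hX : ContinuousOn (fun t : ℝ => conj (thetaMainPhase t) *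
      ∑ n ∈ Finset.Icc 1 P, c n * (n : ℂ) ^ ((t : ℂ) * I)) (Icc T' (T' + U)) :=
    (Complex.continuous_conj.comp_continuousOn
      (continuousOn_thetaMainPhase.mono fun t ht => lt_of_lt_of_le hT'0 ht.1)).mul
      (continuous_dirichletPoly P c).continuousOn
  have hdual := UniversalFactor.narrow_duality (by linarith : T' ≤ T' + U) hg hX
  have hXD : ∫ t in T'..(T' + U), ‖conj (thetaMainPhase t) *
      ∑ n ∈ Finset.Icc 1 P, c n * (n : ℂ) ^ ((t : ℂ) * I)‖ ^ 2 = ID := by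
    rw [hID]
    refine intervalIntegral.integral_congr fun t _ => ?_
    simp only [norm_mul, Complex.norm_conj, norm_thetaMainPhase, one_mul]
  rw [hXD] at hdual
  exact UniversalFactor.narrowClean_endgame (intervalIntegral.integral_nonneg (by linarith) fun t _ => sq_nonneg _)
    hU0 hU1 hSVge hm0 hs0 hJ hdual hID2

/-! ## Tiling: the clean energy lower bound on `[T, 2T]` -/

/-- **The clean narrow energy lower bound** (stub K1a-clean of line `Sketch`):
`∫_T^{2T} (∫ κ_a(u) Z(t+u) du)² dt ≥ c₁ T` for `T ≥ T₁`.  Proof: with `s = T^{1/8}` tile `[T, 2T]`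
into `M = ⌈s²⌉` blocks of length `U = T/M ∈ [s⁶/2, s⁶]` and apply `narrowClean_block` to each.
[folklore] -/
theorem UniversalFactor.stub_narrowEnergyLowerClean : ∀ a : ℝ, π / 8 < a → ∃ c₁ T₁ : ℝ, 0 < c₁ ∧ ∀ T : ℝ, T₁ ≤ T → c₁ * T ≤ ∫ t in T..2 * T, (∫ u : ℝ, Real.exp (-(2 * a * |u|)) * Real.exp (-(π * u / 4)) * hardyZ (t + u)) ^ 2 := by
  intro a ha
  obtain ⟨c₁, S₀, hc₁, hB⟩ := UniversalFactor.narrowClean_block ha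
  refine ⟨c₁, (max S₀ 1) ^ 8, hc₁, fun T hT => ?_⟩
  have hS1 : 1 ≤ max S₀ 1 := le_max_right _ _
  have hT1 : 1 ≤ T := le_trans (one_le_pow₀ hS1) hT
  have hT0 : 0 ≤ T := zero_le_one.trans hT1
  -- `s = T^{1/8}`
  set s : ℝ := Real.sqrt (Real.sqrt (Real.sqrt T)) with hs
  have hs0 : 0 ≤ s := Real.sqrt_nonneg _
  have hs2T : s ^ 2 = Real.sqrt (Real.sqrt T) := Real.sq_sqrt (Real.sqrt_nonneg _)
  have hs4T : s ^ 4 = Real.sqrt T := by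
    rw [show s ^ 4 = (s ^ 2) ^ 2 by ring, hs2T, Real.sq_sqrt (Real.sqrt_nonneg _)]
  have hs8T : s ^ 8 = T := by rw [show s ^ 8 = (s ^ 4) ^ 2 by ring, hs4T, Real.sq_sqrt hT0]
  have hsS : max S₀ 1 ≤ s := by
    rw [← hs8T] at hT
    exact le_of_pow_le_pow_left₀ (by norm_num) hs0 hT
  have hsS₀ : S₀ ≤ s := (le_max_left _ _).trans hsS
  have hs1 : 1 ≤ s := hS1.trans hsS
  -- the number of blocks `M = ⌈s²⌉` and their common length `U = T / M`
  set M : ℕ := ⌈s ^ 2⌉₊ with hM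
  have hMs : s ^ 2 ≤ (M : ℝ) := Nat.le_ceil _
  have hMs1 : (M : ℝ) ≤ s ^ 2 + 1 := (Nat.ceil_lt_add_one (by positivity)).le
  have hMpos : (0 : ℝ) < M := lt_of_lt_of_le (by positivity) hMs
  set U : ℝ := T / M with hU
  have hU0 : 0 ≤ U := div_nonneg hT0 hMpos.le
  have hMU : (M : ℝ) * U = T := mul_div_cancel₀ T hMpos.ne'
  have hUle : U ≤ s ^ 6 := by
    rw [hU, div_le_iff₀ hMpos, ← hs8T]
    calc s ^ 8 = s ^ 6 * s ^ 2 := by ring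
      _ ≤ s ^ 6 * M := mul_le_mul_of_nonneg_left hMs (by positivity)
  have hUge : s ^ 6 / 2 ≤ U := by
    rw [hU, le_div_iff₀ hMpos, ← hs8T]
    have h12 : s ^ 2 + 1 ≤ 2 * s ^ 2 := by nlinarith
    calc s ^ 6 / 2 * M ≤ s ^ 6 / 2 * (s ^ 2 + 1) := mul_le_mul_of_nonneg_left hMs1 (by positivity)
      _ ≤ s ^ 6 / 2 * (2 * s ^ 2) := mul_le_mul_of_nonneg_left h12 (by positivity)
      _ = s ^ 8 := by ring
  -- each block `[T + kU, T + (k+1)U]`, `k < M`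
  have hblk : ∀ k ∈ Finset.range M, c₁ * U ≤
      ∫ t in (T + (k : ℝ) * U)..(T + ((k + 1 : ℕ) : ℝ) * U), (∫ u : ℝ, Real.exp (-(2 * a * |u|)) * Real.exp (-(π * u / 4)) * hardyZ (t + u)) ^ 2 := by
    intro k hk
    have hk' : (k : ℝ) + 1 ≤ M := by exact_mod_cast Finset.mem_range.1 hk
    have hlo : s ^ 8 ≤ T + k * U := by
      rw [hs8T]
      have : 0 ≤ (k : ℝ) * U := by positivity
      linarith
    have hhi : T + k * U ≤ 2 * s ^ 8 := by
      rw [hs8T]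
      have h1 : (k : ℝ) * U ≤ ((M : ℝ) - 1) * U := mul_le_mul_of_nonneg_right (by linarith) hU0
      have h2 : ((M : ℝ) - 1) * U = T - U := by rw [sub_mul, hMU, one_mul]
      linarith
    have h := hB s (T + k * U) U hsS₀ hlo hhi hUge hUle
    rwa [Nat.cast_add, Nat.cast_one, show T + ((k : ℝ) + 1) * U = T + k * U + U by ring]
  -- sum over the blocks
  have hint : ∀ k < M, IntervalIntegrable (fun t : ℝ => (∫ u : ℝ, Real.exp (-(2 * a * |u|)) * Real.exp (-(π * u / 4)) * hardyZ (t + u)) ^ 2) volume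
      (T + (k : ℝ) * U) (T + ((k + 1 : ℕ) : ℝ) * U) :=
    fun k _ => ((UniversalFactor.narrowSmooth_continuous ha).pow 2).intervalIntegrable _ _
  have hsum := intervalIntegral.sum_integral_adjacent_intervals hint
  rw [Nat.cast_zero, zero_mul, add_zero, hMU, ← two_mul] at hsum
  calc c₁ * T = ∑ k ∈ Finset.range M, c₁ * U := by
        rw [Finset.sum_const, Finset.card_range, nsmul_eq_mul, ← hMU]
        ring
    _ ≤ ∑ k ∈ Finset.range M, ∫ t in (T + (k : ℝ) * U)..(T + ((k + 1 : ℕ) : ℝ) * U),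
          (∫ u : ℝ, Real.exp (-(2 * a * |u|)) * Real.exp (-(π * u / 4)) * hardyZ (t + u)) ^ 2 := Finset.sum_le_sum hblk
    _ = _ := hsum

end Summit.RiemannHypothesis.RiemannHypothesis.Theorems
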